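import Mathlib.Combinatorics.SetFamily.FourFunctions
import Mathlib.Combinatorics.SetFamily.Compression.Down
import Mathlib.Tactic
import HarnessLib
import HarnessLib.Audit.Tags
import Summits.CriticalPhenomena.PercolationContinuityZ3.Theorems.PercNearOneGluingNoHeavyLowerTailSahiColouredDaykin
import Summits.CriticalPhenomena.PercolationContinuityZ3.Theorems.PercNearOneGluingNoHeavyLowerTailSahiColouredDaykinCross
import Summits.CriticalPhenomena.PercolationContinuityZ3.Theorems.PercNearOneGluingNoHeavyLowerTailSahiColouredDaykinBrualdi

/-!
# Signed coloured Daykin: the PARTITION form, the RAINBOW form, and the meets-and-joins theorem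

Support file (seat `prim-masterthm-p1`, gen 33; `--supports stmt-CriticalPhenomena-4575`).  Two typed conjectures, two reductions, one
unconditional theorem; no `sorry`, standard axioms.  Memo `run/shared/lean/prim/prim-masterthm/FROM-prim-masterthm-p1-g33-PARTITION-AND-RAINBOW.md`.

CONTEXT.  `SignedColouredDaykin3` (gen 27; crossing form `CrossSignedColouredDaykin3`, gen 28) asks, for a complement-free family `P ⊆ 2^F`
with a 3-colouring, that the ADMISSIBLE DIFFERENCES (`admDiffs`: within-colour differences, cross-colour meets, complemented cross-colour joins)
number at least `#P`.  One colour is Marica–Schönheim, two colours is Marica–Schönheim for `P₀ ∪ {F \ S : S ∈ P₁}`, three is the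
"frustrated" open case.

NEW HERE ([this work], gen 33).
* **The `3` is inessential.**  `PartitionSignedDaykin`: for EVERY labelling `κ : Finset α → ℕ` (i.e. every partition of `P` into classes),
  `#P ≤ #partDiffs` where `partDiffs` = same-label differences ∪ different-label meets ∪ complemented different-label joins.  One class =
  Marica–Schönheim (`card_le_card_partDiffs_of_const`, from Mathlib's `Finset.card_le_card_diffs`); `Fin 3`-labels = `SignedColouredDaykin3`
  (`signedColouredDaykin3_of_partitionSignedDaykin`, via `partDiffs_val_eq_admDiffs`); hence also `CrossSignedColouredDaykin3`.
* **The all-singletons case is the RAINBOW LEMMA** `RainbowMeetCojoin`: for a complement-free family of distinct sets,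
  `#({∅} ∪ {a ∩ b : a ≠ b} ∪ {F \ (a ∪ b) : a ≠ b}) ≥ #P` (`rainbowMeetCojoin_of_partitionSignedDaykin`).  EVIDENCE (engines
  `prim-masterthm-p1/code-g33/`): exhaustive on `2^3, 2^4, 2^5` (all 14 348 906 complement-free families of `2^5`; minimum slack grows ≈ N/2),
  ≈ 10⁹ annealing evaluations in dimensions 6–12 (never within 2 of tight for N ≥ 6); the partition form: 4·10⁵ random configurations with up to
  10 classes and a 48-core annealing campaign, 0 failures; the same statement for a NON-transitive relation (arbitrary graph of "same-colour" pairs)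
  is FALSE on `2^4` (margin −1), so transitivity is used.
* **THEOREM (meets and joins, `card_le_card_meetsJoins`).**  Any `N ≥ 2` distinct finite sets determine at least `N` distinct sets of the form
  `a ∩ b` or `a ∪ b` with `a ≠ b` — the UNTWISTED companion of the rainbow lemma (which replaces `a ∪ b` by `F \ (a ∪ b)`), tight for chains.
  Proof: compression at a point `r` (`card_meetsJoins_compress`: the projections `𝔅` contribute one lift each, the doubled members `𝔄` and their
  meets/joins contribute both lifts), induction on a set containing all members.  The twisted (rainbow) statement does NOT compress this way
  (a doubled member contributes `x` and `F' \ x`, two lower lifts), which is recorded in the memo as the exact obstruction.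
HONEST FRAMING: `PartitionSignedDaykin`, `RainbowMeetCojoin`, `SignedColouredDaykin3` remain OPEN; the theorem is unconditional. [this work]
-/

namespace Summit.CriticalPhenomena.PercolationContinuityZ3.Theorems.SahiColouredDaykin

open Finset
open scoped FinsetFamily

variable {α : Type*} [DecidableEq α]

/-! ### 1. Meets and joins of distinct members (unconditional) -/

/-- Pairwise meets and joins of DISTINCT members of a set family. [this work] -/
def meetsJoins (𝒜 : Finset (Finset α)) : Finset (Finset α) :=
  (𝒜.offDiag.image fun p => p.1 ∩ p.2) ∪ (𝒜.offDiag.image fun p => p.1 ∪ p.2)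

/-- Meets of distinct members lie in `meetsJoins`. [this work] -/
theorem inter_mem_meetsJoins {𝒜 : Finset (Finset α)} {a b : Finset α} (ha : a ∈ 𝒜) (hb : b ∈ 𝒜) (hab : a ≠ b) :
    a ∩ b ∈ meetsJoins 𝒜 :=
  mem_union.2 (Or.inl (mem_image.2 ⟨(a, b), mem_offDiag.2 ⟨ha, hb, hab⟩, rfl⟩))

/-- Joins of distinct members lie in `meetsJoins`. [this work] -/
theorem union_mem_meetsJoins {𝒜 : Finset (Finset α)} {a b : Finset α} (ha : a ∈ 𝒜) (hb : b ∈ 𝒜) (hab : a ≠ b) :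
    a ∪ b ∈ meetsJoins 𝒜 :=
  mem_union.2 (Or.inr (mem_image.2 ⟨(a, b), mem_offDiag.2 ⟨ha, hb, hab⟩, rfl⟩))

/-- Unpacking membership in `meetsJoins`. [this work] -/
theorem mem_meetsJoins_iff {𝒜 : Finset (Finset α)} {Z : Finset α} :
    Z ∈ meetsJoins 𝒜 ↔ ∃ a ∈ 𝒜, ∃ b ∈ 𝒜, a ≠ b ∧ (Z = a ∩ b ∨ Z = a ∪ b) := by
  unfold meetsJoins
  simp only [mem_union, mem_image, mem_offDiag, Prod.exists]
  constructor
  · rintro (⟨a, b, ⟨ha, hb, hab⟩, rfl⟩ | ⟨a, b, ⟨ha, hb, hab⟩, rfl⟩)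
    · exact ⟨a, ha, b, hb, hab, Or.inl rfl⟩
    · exact ⟨a, ha, b, hb, hab, Or.inr rfl⟩
  · rintro ⟨a, ha, b, hb, hab, rfl | rfl⟩
    · exact Or.inl ⟨a, b, ⟨ha, hb, hab⟩, rfl⟩
    · exact Or.inr ⟨a, b, ⟨ha, hb, hab⟩, rfl⟩

/-- The compression step for `meetsJoins` at a point `r`: with `𝔅 = 𝒜.memberSubfamily r ∪ 𝒜.nonMemberSubfamily r` (the projections)
and `𝔄 = 𝒜.memberSubfamily r ∩ 𝒜.nonMemberSubfamily r` (the doubled members), every element of `meetsJoins 𝔅` has a lift in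
`meetsJoins 𝒜` (itself or with `r` inserted), and every element of `meetsJoins 𝔄 ∪ 𝔄` has BOTH lifts. [this work] -/
theorem card_meetsJoins_compress (𝒜 : Finset (Finset α)) (r : α) :
    #(meetsJoins (𝒜.memberSubfamily r ∪ 𝒜.nonMemberSubfamily r)) +
      #(𝒜.memberSubfamily r ∩ 𝒜.nonMemberSubfamily r) ≤ #(meetsJoins 𝒜) ∧
    2 * #(𝒜.memberSubfamily r ∩ 𝒜.nonMemberSubfamily r) ≤ #(meetsJoins 𝒜) := by
  set M := 𝒜.memberSubfamily r with hM
  set N := 𝒜.nonMemberSubfamily r with hN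
  set L := meetsJoins 𝒜 with hL
  -- (1) projections: every element of `meetsJoins (M ∪ N)` is `r`-free and one of its two lifts is in `L`
  have h1 : meetsJoins (M ∪ N) ⊆ L.memberSubfamily r ∪ L.nonMemberSubfamily r := by
    intro W hW
    obtain ⟨x, hx, y, hy, hxy, hW⟩ := mem_meetsJoins_iff.1 hW
    -- lift x and y to members of 𝒜
    have lift : ∀ {z}, z ∈ M ∪ N → r ∉ z ∧ ∃ a ∈ 𝒜, a.erase r = z := by
      intro z hz
      rcases mem_union.1 hz with hz | hz
      · obtain ⟨hz1, hz2⟩ := mem_memberSubfamily.1 hz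
        exact ⟨hz2, insert r z, hz1, erase_insert hz2⟩
      · obtain ⟨hz1, hz2⟩ := mem_nonMemberSubfamily.1 hz
        exact ⟨hz2, z, hz1, erase_eq_of_notMem hz2⟩
    obtain ⟨hrx, a, ha, hax⟩ := lift hx
    obtain ⟨hry, b, hb, hby⟩ := lift hy
    have hab : a ≠ b := by rintro rfl; exact hxy (hax.symm.trans hby)
    have hrW : r ∉ W := by
      rcases hW with rfl | rfl
      · exact fun h => hrx (mem_inter.1 h).1
      · intro h; rcases mem_union.1 h with h | h; exacts [hrx h, hry h]
    -- the lift Z ∈ L with Z.erase r = W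
    have key : ∃ Z ∈ L, Z.erase r = W := by
      rcases hW with rfl | rfl
      · exact ⟨a ∩ b, inter_mem_meetsJoins ha hb hab, by rw [← hax, ← hby]; ext t; simp only [mem_erase, mem_inter]; tauto⟩
      · exact ⟨a ∪ b, union_mem_meetsJoins ha hb hab, by rw [← hax, ← hby]; ext t; simp only [mem_erase, mem_union]; tauto⟩
    obtain ⟨Z, hZ, hZW⟩ := key
    by_cases hrZ : r ∈ Z
    · refine mem_union.2 (Or.inl (mem_memberSubfamily.2 ⟨?_, hrW⟩))
      rwa [← hZW, insert_erase hrZ]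
    · refine mem_union.2 (Or.inr (mem_nonMemberSubfamily.2 ⟨?_, hrW⟩))
      rwa [← hZW, erase_eq_of_notMem hrZ]
  -- (2) doubled members: every element of `meetsJoins (M ∩ N) ∪ (M ∩ N)` has both lifts in `L`
  have h2 : meetsJoins (M ∩ N) ∪ (M ∩ N) ⊆ L.memberSubfamily r ∩ L.nonMemberSubfamily r := by
    intro W hW
    have dbl : ∀ {z}, z ∈ M ∩ N → r ∉ z ∧ z ∈ 𝒜 ∧ insert r z ∈ 𝒜 := by
      intro z hz
      obtain ⟨hzM, hzN⟩ := mem_inter.1 hz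
      exact ⟨(mem_nonMemberSubfamily.1 hzN).2, (mem_nonMemberSubfamily.1 hzN).1, (mem_memberSubfamily.1 hzM).1⟩
    rcases mem_union.1 hW with hW | hW
    · obtain ⟨x, hx, y, hy, hxy, hW⟩ := mem_meetsJoins_iff.1 hW
      obtain ⟨hrx, hx𝒜, hx'⟩ := dbl hx
      obtain ⟨hry, hy𝒜, hy'⟩ := dbl hy
      have hxy' : insert r x ≠ insert r y := by
        intro h; apply hxy
        rw [← erase_insert hrx, ← erase_insert hry, h]
      rcases hW with rfl | rfl
      · have hrW : r ∉ x ∩ y := fun h => hrx (mem_inter.1 h).1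
        refine mem_inter.2 ⟨mem_memberSubfamily.2 ⟨?_, hrW⟩, mem_nonMemberSubfamily.2 ⟨inter_mem_meetsJoins hx𝒜 hy𝒜 hxy, hrW⟩⟩
        have e : insert r (x ∩ y) = insert r x ∩ insert r y := by ext t; simp only [mem_insert, mem_inter]; tauto
        rw [e]; exact inter_mem_meetsJoins hx' hy' hxy'
      · have hrW : r ∉ x ∪ y := by intro h; rcases mem_union.1 h with h | h; exacts [hrx h, hry h]
        refine mem_inter.2 ⟨mem_memberSubfamily.2 ⟨?_, hrW⟩, mem_nonMemberSubfamily.2 ⟨union_mem_meetsJoins hx𝒜 hy𝒜 hxy, hrW⟩⟩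
        have e : insert r (x ∪ y) = insert r x ∪ insert r y := by ext t; simp only [mem_insert, mem_union]; tauto
        rw [e]; exact union_mem_meetsJoins hx' hy' hxy'
    · obtain ⟨hrW, hW𝒜, hW'⟩ := dbl hW
      have hne : W ≠ insert r W := fun h => hrW (by rw [h]; exact mem_insert_self r W)
      refine mem_inter.2 ⟨mem_memberSubfamily.2 ⟨?_, hrW⟩, mem_nonMemberSubfamily.2 ⟨?_, hrW⟩⟩
      · have e : insert r W = W ∪ insert r W := by
          ext t; simp only [mem_insert, mem_union]; tauto
        rw [e]; exact union_mem_meetsJoins hW𝒜 hW' hne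
      · have e : W = W ∩ insert r W := by
          ext t; simp only [mem_insert, mem_inter]; tauto
        rw [e]; exact inter_mem_meetsJoins hW𝒜 hW' hne
  -- (3) count
  have hsplit := card_memberSubfamily_add_card_nonMemberSubfamily r L
  have hui := card_union_add_card_inter (L.memberSubfamily r) (L.nonMemberSubfamily r)
  have c1 := card_le_card h1
  have c2 := card_le_card h2
  have c3 : #(M ∩ N) ≤ #(meetsJoins (M ∩ N) ∪ (M ∩ N)) := card_le_card subset_union_right
  have c4 : #(meetsJoins (M ∩ N) ∪ (M ∩ N)) ≤ #(L.memberSubfamily r ∪ L.nonMemberSubfamily r) :=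
    card_le_card (h2.trans (inter_subset_left.trans subset_union_left))
  constructor <;> omega

/-- **THEOREM (UI): `N ≥ 2` distinct sets determine at least `N` distinct pairwise meets and joins of DISTINCT members.**
Tight for chains.  Proof by compression (induction on a set containing all members). [this work] -/
theorem card_le_card_meetsJoins_of_subset (s : Finset α) :
    ∀ 𝒜 : Finset (Finset α), (∀ a ∈ 𝒜, a ⊆ s) → 2 ≤ #𝒜 → #𝒜 ≤ #(meetsJoins 𝒜) := by
  induction s using Finset.induction_on with
  | empty =>
    intro 𝒜 hs h2
    -- all members are `∅`: at most one member
    have : 𝒜 ⊆ {∅} := fun a ha => mem_singleton.2 (subset_empty.1 (hs a ha))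
    have := card_le_card this
    rw [card_singleton] at this
    omega
  | insert r s hrs ih =>
    intro 𝒜 hs h2
    obtain ⟨hstep, hstep2⟩ := card_meetsJoins_compress 𝒜 r
    have hsum : #(𝒜.memberSubfamily r ∪ 𝒜.nonMemberSubfamily r) + #(𝒜.memberSubfamily r ∩ 𝒜.nonMemberSubfamily r) = #𝒜 := by
      rw [card_union_add_card_inter]; exact card_memberSubfamily_add_card_nonMemberSubfamily r 𝒜
    -- members of the compressed families live inside `s`
    have hsub : ∀ a ∈ 𝒜.memberSubfamily r ∪ 𝒜.nonMemberSubfamily r, a ⊆ s := by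
      intro z hz
      rcases mem_union.1 hz with hz | hz
      · obtain ⟨hz1, hz2⟩ := mem_memberSubfamily.1 hz
        intro t ht
        have := hs _ hz1 (mem_insert_of_mem ht)
        rcases mem_insert.1 this with rfl | h
        · exact absurd ht hz2
        · exact h
      · obtain ⟨hz1, hz2⟩ := mem_nonMemberSubfamily.1 hz
        intro t ht
        have := hs _ hz1 ht
        rcases mem_insert.1 this with rfl | h
        · exact absurd ht hz2
        · exact h
    by_cases hB : 2 ≤ #(𝒜.memberSubfamily r ∪ 𝒜.nonMemberSubfamily r)
    · have := ih _ hsub hB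
      omega
    · -- `#(M ∪ N) ≤ 1`: then `#(M ∩ N) ≤ 1`, `#𝒜 = 2` and `#(M ∩ N) = 1`
      have hle : #(𝒜.memberSubfamily r ∩ 𝒜.nonMemberSubfamily r) ≤ #(𝒜.memberSubfamily r ∪ 𝒜.nonMemberSubfamily r) :=
        card_le_card (inter_subset_left.trans subset_union_left)
      omega

/-- **THEOREM (UI), absolute form.** [this work] -/
theorem card_le_card_meetsJoins (𝒜 : Finset (Finset α)) (h2 : 2 ≤ #𝒜) : #𝒜 ≤ #(meetsJoins 𝒜) :=
  card_le_card_meetsJoins_of_subset (𝒜.sup id) 𝒜 (fun _ ha => le_sup (f := id) ha) h2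


/-! ### 2. The partition form of signed coloured Daykin -/

section partition
variable {F : Finset α} {P : Finset (Finset α)}

/-- **Partition differences** for a labelling `κ` of the members (classes = fibres of `κ`): same-label differences, different-label meets,
complemented different-label joins.  For `Fin 3`-valued labels this is `admDiffs` (`partDiffs_val_eq_admDiffs`). [this work] -/
def partDiffs (F : Finset α) (P : Finset (Finset α)) (κ : Finset α → ℕ) : Finset (Finset α) :=
  (((P ×ˢ P).filter fun pq => κ pq.1 = κ pq.2).image fun pq => pq.1 \ pq.2) ∪
    ((((P ×ˢ P).filter fun pq => κ pq.1 ≠ κ pq.2).image fun pq => pq.1 ∩ pq.2) ∪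
      (((P ×ˢ P).filter fun pq => κ pq.1 ≠ κ pq.2).image fun pq => F \ (pq.1 ∪ pq.2)))

/-- **CONJECTURE (partition form of signed coloured Daykin; typed).**  For every complement-free family `P ⊆ 2^F` and EVERY labelling of its
members, `#P ≤ #partDiffs`.  One label = Marica–Schönheim; three labels = `SignedColouredDaykin3`; pairwise distinct labels = `RainbowMeetCojoin`.
Evidence in the file header. [this work] [status: open] -/
@[conjecture] def PartitionSignedDaykin (α : Type*) [DecidableEq α] : Prop :=
  ∀ (F : Finset α) (P : Finset (Finset α)) (κ : Finset α → ℕ),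
    (∀ S ∈ P, S ⊆ F) → (∀ S ∈ P, F \ S ∉ P) → #P ≤ #(partDiffs F P κ)

/-- One class: the partition differences contain all differences `P \\ P`, so the bound is Marica–Schönheim (Mathlib
`Finset.card_le_card_diffs`). [this work] -/
theorem card_le_card_partDiffs_of_const (F : Finset α) (P : Finset (Finset α)) (κ : Finset α → ℕ)
    (hκ : ∀ S ∈ P, ∀ T ∈ P, κ S = κ T) : #P ≤ #(partDiffs F P κ) := by
  refine (Finset.card_le_card_diffs P).trans (card_le_card ?_)
  intro Z hZ
  obtain ⟨a, ha, b, hb, rfl⟩ := Finset.mem_diffs.1 hZ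
  exact mem_union.2 (Or.inl (mem_image.2 ⟨(a, b), mem_filter.2 ⟨mem_product.2 ⟨ha, hb⟩, hκ a ha b hb⟩, rfl⟩))

/-- `Fin 3`-valued labels: `partDiffs` is literally `admDiffs`. [this work] -/
theorem partDiffs_val_eq_admDiffs (F : Finset α) (P : Finset (Finset α)) (c : Finset α → Fin 3) :
    partDiffs F P (fun S => ((c S : ℕ))) = admDiffs F P c := by
  unfold partDiffs admDiffs samePairs crossPairs
  have h1 : ((P ×ˢ P).filter fun pq => ((c pq.1 : ℕ)) = (c pq.2 : ℕ)) = (P ×ˢ P).filter fun pq => c pq.1 = c pq.2 :=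
    filter_congr fun pq _ => Fin.val_inj
  have h2 : ((P ×ˢ P).filter fun pq => ((c pq.1 : ℕ)) ≠ (c pq.2 : ℕ)) = (P ×ˢ P).filter fun pq => c pq.1 ≠ c pq.2 :=
    filter_congr fun pq _ => not_congr Fin.val_inj
  rw [h1, h2]

/-- **`PartitionSignedDaykin ⟹ SignedColouredDaykin3`.** [this work] -/
theorem signedColouredDaykin3_of_partitionSignedDaykin (h : PartitionSignedDaykin α) : SignedColouredDaykin3 α := by
  intro F P c hPF hnc
  have := h F P (fun S => ((c S : ℕ))) hPF hnc
  rw [partDiffs_val_eq_admDiffs] at this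
  exact this.trans (card_admDiffs_le_card_compatJoins hPF)

/-- **`PartitionSignedDaykin ⟹ CrossSignedColouredDaykin3`** (what the three-petal reduction needs). [this work] -/
theorem crossSignedColouredDaykin3_of_partitionSignedDaykin (h : PartitionSignedDaykin α) : CrossSignedColouredDaykin3 α :=
  crossSignedColouredDaykin3_of_signedColouredDaykin3 (signedColouredDaykin3_of_partitionSignedDaykin h)

end partition

/-! ### 3. The rainbow form -/

section rainbow

/-- **Rainbow meets**: `∅`, the meets of distinct members, and the complemented joins of distinct members. [this work] -/
def rainbowMeets (F : Finset α) (P : Finset (Finset α)) : Finset (Finset α) :=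
  insert ∅ ((P.offDiag.image fun pq => pq.1 ∩ pq.2) ∪ (P.offDiag.image fun pq => F \ (pq.1 ∪ pq.2)))

/-- **CONJECTURE (rainbow lemma; typed).**  A complement-free family `P ⊆ 2^F` of distinct sets has at least `#P` rainbow meets.  This is
`PartitionSignedDaykin` for pairwise distinct labels (`rainbowMeetCojoin_of_partitionSignedDaykin`); exhaustive on `2^n`, `n ≤ 5`, annealing-clean
in dimensions `6–12` (file header); tight e.g. for `{∅, {0,1}, {0,2}, {1,2}} ⊆ 2^{[3]}` (`card_rainbowMeets_triangle`). [this work] [status: open] -/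
@[conjecture] def RainbowMeetCojoin (α : Type*) [DecidableEq α] : Prop :=
  ∀ (F : Finset α) (P : Finset (Finset α)), (∀ S ∈ P, S ⊆ F) → (∀ S ∈ P, F \ S ∉ P) → #P ≤ #(rainbowMeets F P)

/-- With pairwise distinct labels on `P`, the partition differences are rainbow meets. [this work] -/
theorem partDiffs_subset_rainbowMeets (F : Finset α) (P : Finset (Finset α)) (κ : Finset α → ℕ)
    (hκ : ∀ S ∈ P, ∀ T ∈ P, κ S = κ T → S = T) : partDiffs F P κ ⊆ rainbowMeets F P := by
  intro Z hZ
  unfold partDiffs at hZ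
  unfold rainbowMeets
  simp only [mem_union, mem_image, mem_filter, mem_product, Prod.exists] at hZ
  rcases hZ with ⟨a, b, ⟨⟨ha, hb⟩, hab⟩, rfl⟩ | ⟨a, b, ⟨⟨ha, hb⟩, hab⟩, rfl⟩ | ⟨a, b, ⟨⟨ha, hb⟩, hab⟩, rfl⟩
  · have : a = b := hκ a ha b hb hab
    subst this
    rw [sdiff_self]; exact mem_insert_self _ _
  · have hne : a ≠ b := fun h => hab (by rw [h])
    exact mem_insert_of_mem (mem_union.2 (Or.inl (mem_image.2 ⟨(a, b), mem_offDiag.2 ⟨ha, hb, hne⟩, rfl⟩)))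
  · have hne : a ≠ b := fun h => hab (by rw [h])
    exact mem_insert_of_mem (mem_union.2 (Or.inr (mem_image.2 ⟨(a, b), mem_offDiag.2 ⟨ha, hb, hne⟩, rfl⟩)))

/-- **`PartitionSignedDaykin ⟹ RainbowMeetCojoin`** (label the members injectively). [this work] -/
theorem rainbowMeetCojoin_of_partitionSignedDaykin (h : PartitionSignedDaykin α) : RainbowMeetCojoin α := by
  classical
  intro F P hPF hnc
  -- an injective labelling of the members of `P`
  let e := P.equivFin
  let κ : Finset α → ℕ := fun S => if hS : S ∈ P then (e ⟨S, hS⟩ : ℕ) else 0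
  have hκ : ∀ S ∈ P, ∀ T ∈ P, κ S = κ T → S = T := by
    intro S hS T hT hST
    have h1 : κ S = (e ⟨S, hS⟩ : ℕ) := dif_pos hS
    have h2 : κ T = (e ⟨T, hT⟩ : ℕ) := dif_pos hT
    rw [h1, h2] at hST
    have := e.injective (Fin.ext hST)
    exact congrArg Subtype.val this
  exact (h F P κ hPF hnc).trans (card_le_card (partDiffs_subset_rainbowMeets F P κ hκ))

/-- A tight instance of the rainbow lemma: `{∅, {0,1}, {0,2}, {1,2}} ⊆ 2^{[3]}` has exactly four rainbow meets (`∅, {0}, {1}, {2}`).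
[this work] -/
theorem card_rainbowMeets_triangle :
    #(rainbowMeets (Finset.univ : Finset (Fin 3)) ({∅, {0, 1}, {0, 2}, {1, 2}} : Finset (Finset (Fin 3)))) = 4 := by
  decide

end rainbow

end Summit.CriticalPhenomena.PercolationContinuityZ3.Theorems.SahiColouredDaykin
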